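import Summits.QuantumFields.YangMills.Theses.ToronCumulantSign
import Summits.QuantumFields.YangMills.Theorems.ToronCumulantSignInnerMoment
import Summits.Ventures.YMGap.Thresholds.HaarFourthMomentSUNTrace

/-!
# Route `ToronCumulantSign` — the crux `CommutatorSkewMoment` (stmt-QuantumFields-27530), PROVED

★★ For every `N ≥ 2`, with `dX, dY` the Haar probability measures of `SU(N)`:

  `κ_N := ∫∫ (|tr X|² − 1)(|tr Y|² − 1) Re tr(X Y X⁻¹ Y⁻¹) dX dY = −1/(N(N² − 1))`

(`N = 2`: `−1/6`, matching the barrier's Haar Monte Carlo `−0.1664(17)`, kit j022105; `N = 3`: `−1/24`).  Proof (no Weingarten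
calculus, invariance only): the inner `Y`-integral is `(|tr X|² − 1)·(N² − |tr X|²)/(N(N²−1))` by helper III
(`integral_normSqTrace_sub_one_traceConj`: the `|tr|²`-weighted second moment `γ_N δδ + C_N δδ` from the `ζ₅` phase-twist support
lemmas of helper I and the position-free modulus moments of helper II, minus the Schur term `|tr X|²/N`), and the outer
`X`-integral uses `∫|tr X|² = 1`, `∫|tr X|⁴ = 2` (venture files `RobustBall.HaarSecondMoments`, `HaarFourthMomentSUNTrace`;
`N = 2` via `∫ (Re tr)⁴ = 2` and reality of the `SU(2)` trace): `(N²·1 − 2 − N² + 1)/(N(N²−1)) = −1/(N(N²−1))`.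

HONEST LABEL: this closes crux 2 of the barrier-ledger line `ToronCumulantSign` (Griffiths II fails for `SU(N)` plaquette
energies on the one-site torus); crux 3 `OneSiteCovDerivative` remains OPEN here, so the barrier fact `ToronPlaneAnticorrelation`
is NOT yet discharged; nothing about any LADDER-YM rung or the Yang–Mills mass gap.

References: B. Collins, P. Śniady, CMP 264 (2006) 773–795, Cor. 2.4 [CollinsSniady2006]; M. Creutz, *Quarks, gluons and
lattices* (1983) §8 [doi:10.1017/9781009290395].
-/

noncomputable section

open MeasureTheory Complex
open Literature.MathematicalPhysics.QuantumLattice Literature.MathematicalPhysics.QuantumFieldTheory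

namespace Summit.QuantumFields.YangMills.Theorems.ToronCumulantSign

open Summit.Ventures.YMGap

/-- Local shorthand: `SU(2+n)`. -/
local notation3 (prettyPrint := false) "SUn" n:max => Matrix.specialUnitaryGroup (Fin (2 + n)) ℂ

/-- The commutator read in matrices: `↑(X Y X⁻¹ Y⁻¹) = X Y X† Y†`. [folklore] -/
theorem coe_commutator {n : ℕ} (X Y : SUn n) :
    ((X * Y * X⁻¹ * Y⁻¹ : SUn n) : Matrix (Fin (2 + n)) (Fin (2 + n)) ℂ) =
      (X : Matrix (Fin (2 + n)) (Fin (2 + n)) ℂ) * (Y : Matrix (Fin (2 + n)) (Fin (2 + n)) ℂ) *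
        (X : Matrix (Fin (2 + n)) (Fin (2 + n)) ℂ).conjTranspose * (Y : Matrix (Fin (2 + n)) (Fin (2 + n)) ℂ).conjTranspose := by
  rfl

/-- ★ **The inner integral in closed form**: for `X ∈ SU(N)`,
`∫ (|tr X|² − 1)(|tr Y|² − 1) Re tr(XYX⁻¹Y⁻¹) dY = (|tr X|² − 1)(N² − |tr X|²)/(N(N²−1))`. [folklore] -/
theorem inner_integral_eq {n : ℕ} (X : SUn n) :
    ∫ Y, (Complex.normSq (X : Matrix (Fin (2 + n)) (Fin (2 + n)) ℂ).trace - 1) *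
        (Complex.normSq (Y : Matrix (Fin (2 + n)) (Fin (2 + n)) ℂ).trace - 1) *
        ((X * Y * X⁻¹ * Y⁻¹ : SUn n) : Matrix (Fin (2 + n)) (Fin (2 + n)) ℂ).trace.re ∂haarProbability (SUn n) =
      (Complex.normSq (X : Matrix (Fin (2 + n)) (Fin (2 + n)) ℂ).trace - 1) *
        (((2 + n : ℝ) ^ 2 - Complex.normSq (X : Matrix (Fin (2 + n)) (Fin (2 + n)) ℂ).trace) /
          ((2 + n : ℝ) * ((1 + n : ℝ) * (3 + n)))) := by
  set XM : Matrix (Fin (2 + n)) (Fin (2 + n)) ℂ := (X : Matrix (Fin (2 + n)) (Fin (2 + n)) ℂ) with hXM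
  have hρ := TorusAreaLaw.isSpecialUnitaryModel_fundamentalRep (2 + n)
  have hXu : XM ∈ Matrix.unitaryGroup (Fin (2 + n)) ℂ := X.2.1
  -- the complex integrand `F(Y) = (|tr Y|² − 1) tr(X Y X† Y†)` and its integral (helper III)
  have hF := integral_normSqTrace_sub_one_traceConj (fundamentalRep (Fin (2 + n))) hρ hXu
  simp only [fundamentalRep_apply] at hF
  have hcont : Continuous fun Y : SUn n => ((((Complex.normSq (Y : Matrix (Fin (2 + n)) (Fin (2 + n)) ℂ).trace : ℝ) : ℂ) - 1) *
      (XM * (Y : Matrix (Fin (2 + n)) (Fin (2 + n)) ℂ) * XM.conjTranspose *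
        (Y : Matrix (Fin (2 + n)) (Fin (2 + n)) ℂ).conjTranspose).trace) := by
    have h1 : Continuous fun Y : SUn n => (Y : Matrix (Fin (2 + n)) (Fin (2 + n)) ℂ) := continuous_subtype_val
    refine ((Complex.continuous_ofReal.comp (Complex.continuous_normSq.comp (continuous_id.matrix_trace.comp h1))).sub
      continuous_const).mul ?_
    exact continuous_id.matrix_trace.comp
      (((continuous_const.mul h1).mul continuous_const).mul (continuous_id.matrix_conjTranspose.comp h1))
  have hint : Integrable (fun Y : SUn n => ((((Complex.normSq (Y : Matrix (Fin (2 + n)) (Fin (2 + n)) ℂ).trace : ℝ) : ℂ) - 1) *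
      (XM * (Y : Matrix (Fin (2 + n)) (Fin (2 + n)) ℂ) * XM.conjTranspose *
        (Y : Matrix (Fin (2 + n)) (Fin (2 + n)) ℂ).conjTranspose).trace)) (haarProbability (SUn n)) :=
    hcont.integrable_of_hasCompactSupport (HasCompactSupport.of_compactSpace _)
  -- the real integrand is `(|tr X|² − 1) · Re F(Y)`
  have hpt : ∀ Y : SUn n, (Complex.normSq XM.trace - 1) *
      (Complex.normSq (Y : Matrix (Fin (2 + n)) (Fin (2 + n)) ℂ).trace - 1) *
        ((X * Y * X⁻¹ * Y⁻¹ : SUn n) : Matrix (Fin (2 + n)) (Fin (2 + n)) ℂ).trace.re =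
      (Complex.normSq XM.trace - 1) * ((((Complex.normSq (Y : Matrix (Fin (2 + n)) (Fin (2 + n)) ℂ).trace : ℝ) : ℂ) - 1) *
        (XM * (Y : Matrix (Fin (2 + n)) (Fin (2 + n)) ℂ) * XM.conjTranspose *
          (Y : Matrix (Fin (2 + n)) (Fin (2 + n)) ℂ).conjTranspose).trace).re := by
    intro Y
    rw [coe_commutator, ← Complex.ofReal_one, ← Complex.ofReal_sub, Complex.re_ofReal_mul, mul_assoc]
  simp_rw [hpt]
  rw [integral_const_mul]
  congr 1
  have hre := integral_re hint
  simp only [RCLike.re_to_complex] at hre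
  rw [hre, hF, Complex.ofReal_re]

/-- `∫_{SU(N)} |tr X|⁴ dX = 2` for every `N ≥ 2` (venture `integral_normSq_trace_sq_suN` for `N ≥ 3`; `N = 2` from
`∫ (Re tr)⁴ = 2` and the reality of the `SU(2)` trace). [folklore] -/
theorem integral_normSq_trace_sq_two_add (n : ℕ) :
    ∫ X, Complex.normSq (X : Matrix (Fin (2 + n)) (Fin (2 + n)) ℂ).trace ^ 2 ∂haarProbability (SUn n) = 2 := by
  rcases Nat.eq_zero_or_pos n with hn | hn
  · subst hn
    have h := HaarFourthMoment.integral_reTr_pow_four_su2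
    have hreal : ∀ X : SUn 0, Complex.normSq (X : Matrix (Fin (2 + 0)) (Fin (2 + 0)) ℂ).trace ^ 2 =
        ((X : Matrix (Fin 2) (Fin 2) ℂ).trace.re) ^ 4 := by
      intro X
      have hc := RobustBall.HaarSecondMoments.conj_trace_eq_of_two (fundamentalRep (Fin 2))
        (TorusAreaLaw.isSpecialUnitaryModel_fundamentalRep 2) X
      simp only [fundamentalRep_apply] at hc
      have him : ((X : Matrix (Fin 2) (Fin 2) ℂ).trace).im = 0 := Complex.conj_eq_iff_im.mp hc
      have : Complex.normSq (X : Matrix (Fin 2) (Fin 2) ℂ).trace = ((X : Matrix (Fin 2) (Fin 2) ℂ).trace.re) ^ 2 := by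
        rw [Complex.normSq_apply, him]; ring
      change Complex.normSq (X : Matrix (Fin 2) (Fin 2) ℂ).trace ^ 2 = _
      rw [this]; ring
    simp_rw [hreal]
    exact h
  · exact HaarFourthMomentSUN.integral_normSq_trace_sq_suN (N := 2 + n) (by omega)

/-- ★★ **Crux `CommutatorSkewMoment` of route `ToronCumulantSign`** (stmt-QuantumFields-27530): `κ_N = −1/(N(N²−1))` for every
`N ≥ 2`. -/
theorem commutatorSkewMoment_proof : Summit.QuantumFields.YangMills.Theses.ToronCumulantSign.CommutatorSkewMoment := by
  intro N hN
  obtain ⟨n, rfl⟩ := Nat.exists_eq_add_of_le hN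
  simp_rw [inner_integral_eq]
  -- the outer integral: `∫ (a − 1)(N² − a)/D da` with `∫ a = 1`, `∫ a² = 2`
  set D : ℝ := (2 + n : ℝ) * ((1 + n : ℝ) * (3 + n)) with hD
  have hDpos : 0 < D := by rw [hD]; positivity
  have hc : Continuous fun X : SUn n => Complex.normSq (X : Matrix (Fin (2 + n)) (Fin (2 + n)) ℂ).trace :=
    Complex.continuous_normSq.comp (continuous_id.matrix_trace.comp continuous_subtype_val)
  have hi1 : Integrable (fun X : SUn n => Complex.normSq (X : Matrix (Fin (2 + n)) (Fin (2 + n)) ℂ).trace)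
      (haarProbability (SUn n)) := hc.integrable_of_hasCompactSupport (HasCompactSupport.of_compactSpace _)
  have hi2 : Integrable (fun X : SUn n => Complex.normSq (X : Matrix (Fin (2 + n)) (Fin (2 + n)) ℂ).trace ^ 2)
      (haarProbability (SUn n)) := (hc.pow 2).integrable_of_hasCompactSupport (HasCompactSupport.of_compactSpace _)
  have hpt : ∀ X : SUn n, (Complex.normSq (X : Matrix (Fin (2 + n)) (Fin (2 + n)) ℂ).trace - 1) *
      (((2 + n : ℝ) ^ 2 - Complex.normSq (X : Matrix (Fin (2 + n)) (Fin (2 + n)) ℂ).trace) / D) =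
      D⁻¹ * ((((2 + n : ℝ) ^ 2 + 1) * Complex.normSq (X : Matrix (Fin (2 + n)) (Fin (2 + n)) ℂ).trace -
        Complex.normSq (X : Matrix (Fin (2 + n)) (Fin (2 + n)) ℂ).trace ^ 2) - (2 + n : ℝ) ^ 2) := by
    intro X
    field_simp
    ring
  simp_rw [hpt]
  have hi3 : Integrable (fun X : SUn n => ((2 + n : ℝ) ^ 2 + 1) * Complex.normSq (X : Matrix (Fin (2 + n)) (Fin (2 + n)) ℂ).trace -
      Complex.normSq (X : Matrix (Fin (2 + n)) (Fin (2 + n)) ℂ).trace ^ 2) (haarProbability (SUn n)) :=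
    (hi1.const_mul _).sub hi2
  rw [integral_const_mul, integral_sub hi3 (integrable_const _), integral_sub (hi1.const_mul _) hi2,
    integral_const_mul, integral_normSq_trace_sq_two_add n,
    RobustBall.HaarSecondMoments.integral_normSq_trace_suN (N := 2 + n) (by omega), integral_const]
  simp only [probReal_univ, smul_eq_mul, one_mul]
  rw [hD]
  push_cast
  have hden : (2 + (n : ℝ)) * ((2 + (n : ℝ)) ^ 2 - 1) = (2 + n) * ((1 + n) * (3 + n)) := by ring
  rw [hden]
  have hpos1 : (0 : ℝ) < (1 + n : ℝ) := by positivity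
  have hpos2 : (0 : ℝ) < (2 + n : ℝ) := by positivity
  have hpos3 : (0 : ℝ) < (3 + n : ℝ) := by positivity
  field_simp
  ring

end Summit.QuantumFields.YangMills.Theorems.ToronCumulantSign
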